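import Mathlib

/-!
# NoGo / EPhiVcIff — scalar skeleton of census-1 THEOREM VC-IFF (door D-K4 is an exact
characterisation) and THEOREM EPHI-2 (the LD-boundary survivor `Z + ∫|ω|² ℓ(|ω|/Ω_LD)`)

search for candidate a priori estimates; no regularity claim.

Companion of `NoGo/EPhiImmune.lean` (p228874) and `NoGo/EPhiImmuneC2.lean` (nogo, staged).
The PDE bookkeeping (which integral is which) is in census-1
`pub-nsfunc-census-1/exact/ephi-A/vciff/VC-IFF-A.md` (METHODS (cc.34)), nogo
`pub-nsfunc-nogo/ephi/N19-EPHI.md` §8 (THEOREM N19 (d), necessity) and census-2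
`pub-nsfunc-census-2/exact/ephi-B/VC-CHECK-B.md` ((dd.42), necessity bookkeeping).

Setting (planar shear heat flow, reference-scale functional `F = ∫ Ω^Q Φ(|ω|/Ω)`):
`dF/dt = ν (c·𝒥 − 𝒟)` with `𝒥 = s ∫ w² g_Φ(|w|/Ω)`, `𝒟 = s ∫ Φ″(|w|/Ω) w′²`, `s = Ω^(Q−2) > 0`,
`c_LD = 4P/Z`, `c_RQ = 2P/Z − Z/K`.  With `G = sup g_Φ`, `m = inf Φ″` one has the pointwise
consequences `𝒥 ≤ s·G·Z` and `s·m·P ≤ 𝒟`; the lemmas below then give `c·𝒥 − 𝒟 ≤ 0` under the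
survival condition `(VC)  m ≥ c_max · G` (`c_max = 4` for LD, `2` for RQ).

* `cRQ_nonneg`, `cRQ_le` : `0 ≤ 2P/Z − Z/K ≤ 2P/Z` from the Cauchy–Schwarz consequence `Z² ≤ 2KP`.
* `vc_suff_LD`, `vc_suff_RQ` : sufficiency of (VC) for the two reference scales.
* `readingR_suff` : under reading R the rate is `ν c 𝒥 ≤ 0` as soon as `G ≤ 0`.
* `ephi2_weight_nonneg`, `ephi2_inertial_le`, `ephi2_viscous_nonpos` :
  the real-arithmetic steps of THEOREM EPHI-2 (`A ≥ 1`); the pointwise production bound and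
  the row assembly are `NoGo.EPhiImmuneC2.production_density_le` / `row_holds_C_two` (tree,
  p232353) and are not restated here.
* `ephi2_threshold`, `ephi2_dead_margin` : the threshold `A = 1` and the limiting kill margin.
* `dissipation3D_floor`, `viscous3D_nonpos`, `inertial_weight_general`, `production_le_QF`,
  `production_le_cQF`, `margin_upper`, `margin_bound_q2LDj1` : census-1's countersign cuts of
  nogo THEOREM N20 (B)/(A′) = dict THEOREM DK4⁺ (3-D sufficiency, production side, margin bound).

All statements are closed real-arithmetic facts.
-/

namespace Summit.NavierStokesRegularity.FunctionalMining.NoGo.EPhiVcIff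

/-- Cauchy–Schwarz consequence: from `Z² ≤ 2KP` (i.e. `(∫W W″)² ≤ ∫W² ∫W″²`), `K > 0`, `Z > 0`
one gets `0 ≤ c_RQ = 2P/Z − Z/K`. -/
theorem cRQ_nonneg (Z K P : ℝ) (hZ : 0 < Z) (hK : 0 < K) (hCS : Z ^ 2 ≤ 2 * K * P) :
    0 ≤ 2 * P / Z - Z / K := by
  rw [sub_nonneg, div_le_div_iff₀ hK hZ]
  nlinarith

/-- And trivially `c_RQ ≤ 2P/Z` (`Z/K ≥ 0`). -/
theorem cRQ_le (Z K P : ℝ) (hZ : 0 < Z) (hK : 0 < K) : 2 * P / Z - Z / K ≤ 2 * P / Z := by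
  have h : 0 ≤ Z / K := div_nonneg hZ.le hK.le
  linarith

/-- `c_LD = 4P/Z` satisfies the normalisation `c·Z = 4P` used below. -/
theorem cLD_mul (Z P : ℝ) (hZ : 0 < Z) : (4 * P / Z) * Z = 4 * P := by
  field_simp

/-- `c_RQ` satisfies `c·Z ≤ 2P`. -/
theorem cRQ_mul_le (Z K P : ℝ) (hZ : 0 < Z) (hK : 0 < K) :
    (2 * P / Z - Z / K) * Z ≤ 2 * P := by
  have h1 : (2 * P / Z - Z / K) * Z = 2 * P - Z * Z / K := by
    field_simp
  rw [h1]
  have h2 : 0 ≤ Z * Z / K := by positivity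
  linarith

/-- SUFFICIENCY of (VC), LD scale (`c·Z = 4P` exactly; no sign condition on `G`):
`J ≤ s·G·Z`, `s·m·P ≤ D`, `4G ≤ m` ⇒ `c·J − D ≤ 0`. -/
theorem vc_suff_LD (c s Z P G m J D : ℝ) (hc : 0 ≤ c) (hcZ : c * Z = 4 * P) (hs : 0 < s)
    (hP : 0 ≤ P) (hJ : J ≤ s * G * Z) (hD : s * m * P ≤ D) (hVC : 4 * G ≤ m) :
    c * J - D ≤ 0 := by
  have h1 : c * J ≤ c * (s * G * Z) := mul_le_mul_of_nonneg_left hJ hc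
  have h2 : c * (s * G * Z) = s * G * (c * Z) := by ring
  have h3 : s * G * (4 * P) ≤ s * m * P := by nlinarith [mul_nonneg hs.le hP]
  rw [h2, hcZ] at h1
  linarith

/-- SUFFICIENCY of (VC), RQ scale (`0 ≤ c`, `c·Z ≤ 2P`; here `G ≥ 0`, which is automatic for
`Φ(x) = x^Q h(x)`, `h ∈ C¹`, since then `g_Φ(x) = x^(Q−1) h′(x) → 0` as `x → 0⁺`):
`J ≤ s·G·Z`, `s·m·P ≤ D`, `2G ≤ m` ⇒ `c·J − D ≤ 0`. -/
theorem vc_suff_RQ (c s Z P G m J D : ℝ) (hc : 0 ≤ c) (hcZ : c * Z ≤ 2 * P) (hs : 0 < s)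
    (hP : 0 ≤ P) (hG : 0 ≤ G) (hJ : J ≤ s * G * Z) (hD : s * m * P ≤ D) (hVC : 2 * G ≤ m) :
    c * J - D ≤ 0 := by
  have h1 : c * J ≤ c * (s * G * Z) := mul_le_mul_of_nonneg_left hJ hc
  have h2 : c * (s * G * Z) = s * G * (c * Z) := by ring
  have hsG : 0 ≤ s * G := mul_nonneg hs.le hG
  have h3 : s * G * (c * Z) ≤ s * G * (2 * P) := mul_le_mul_of_nonneg_left hcZ hsG
  have h4 : s * G * (2 * P) ≤ s * m * P := by nlinarith [mul_nonneg hs.le hP]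
  rw [h2] at h1
  linarith

/-- Reading R: the rate is `ν·c·J`; with `c ≥ 0` and `J ≤ s·G·Z`, `G ≤ 0` it is `≤ 0`. -/
theorem readingR_suff (ν c s Z G J : ℝ) (hν : 0 ≤ ν) (hc : 0 ≤ c) (hs : 0 < s) (hZ : 0 < Z)
    (hG : G ≤ 0) (hJ : J ≤ s * G * Z) : ν * c * J ≤ 0 := by
  have h1 : s * G * Z ≤ 0 := by
    have : s * Z * G ≤ 0 := mul_nonpos_of_nonneg_of_nonpos (by positivity) hG
    linarith [show s * G * Z = s * Z * G by ring]
  have h2 : J ≤ 0 := le_trans hJ h1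
  have h3 : 0 ≤ ν * c := mul_nonneg hν hc
  exact mul_nonpos_of_nonneg_of_nonpos h3 h2

/-! ### THEOREM EPHI-2: `F_A = A·Z + ∫ |ω|² ℓ(|ω|/Ω_LD)`, `ℓ = log (e + ·) ≥ 1`, `θ = r/(e+r) ∈ [0,1)`.
On every smooth solution `dF_A/dt = N + V` with
`N = ∫ σ · (2A + 2ℓ + θ − 4𝒥/Z)` (inertial bracket, `𝒥 = ∫ |ω|² θ ≤ Z`) and
`V = −2AνP − D_Φ + (4νP/Z)·𝒥` (viscous bracket, `D_Φ ≥ 2νP` by `EPhiImmuneC2.tangential_ge_two /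
radial_ge_two`). -/

/-- The inertial weight `2A + 2ℓ + θ − 4·(J/Z)` is nonnegative for `A ≥ 1`. -/
theorem ephi2_weight_nonneg (A ℓ θ J Z : ℝ) (hA : 1 ≤ A) (hℓ : 1 ≤ ℓ) (hθ : 0 ≤ θ)
    (hZ : 0 < Z) (hJ : J ≤ Z) : 0 ≤ 2 * A + 2 * ℓ + θ - 4 * (J / Z) := by
  have hq : J / Z ≤ 1 := by rw [div_le_one hZ]; exact hJ
  linarith

/-- Integrated inertial bracket: `N ≤ α⁺·(2AZ + 2F_Φ + J − 4J) ≤ 2 α⁺ (A Z + F_Φ)` (`J ≥ 0`). -/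
theorem ephi2_inertial_le (N aplus A Z FΦ J : ℝ) (ha : 0 ≤ aplus) (hJ : 0 ≤ J)
    (hN : N ≤ aplus * (2 * A * Z + 2 * FΦ + J - 4 * J)) :
    N ≤ 2 * aplus * (A * Z + FΦ) := by
  have h : 0 ≤ aplus * J := mul_nonneg ha hJ
  nlinarith

/-- Viscous bracket: `−2AνP − D + (4νP/Z)·J ≤ −2(A−1)νP ≤ 0` for `A ≥ 1`, `D ≥ 2νP`, `J ≤ Z`. -/
theorem ephi2_viscous_nonpos (A ν P Z J D : ℝ) (hA : 1 ≤ A) (hν : 0 ≤ ν) (hP : 0 ≤ P)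
    (hZ : 0 < Z) (hJ : J ≤ Z) (hD : 2 * ν * P ≤ D) :
    -2 * A * ν * P - D + (4 * ν * P / Z) * J ≤ -(2 * (A - 1) * ν * P) ∧
      -(2 * (A - 1) * ν * P) ≤ 0 := by
  have hq : J / Z ≤ 1 := by rw [div_le_one hZ]; exact hJ
  have h2 : (4 * ν * P / Z) * J = 4 * ν * P * (J / Z) := by field_simp
  have h3 : 0 ≤ 4 * ν * P := by positivity
  have h1 : (4 * ν * P / Z) * J ≤ 4 * ν * P := by
    rw [h2]
    calc 4 * ν * P * (J / Z) ≤ 4 * ν * P * 1 := mul_le_mul_of_nonneg_left hq h3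
      _ = 4 * ν * P := by ring
  have h4 : 0 ≤ 2 * (A - 1) * ν * P := by
    have : 0 ≤ A - 1 := by linarith
    positivity
  constructor <;> nlinarith

/-- Dead side of the threshold: for `Φ_A = x²(A + ℓ)` one has `inf Φ″ = 2A + 2`, `sup g = 1`,
so the LD condition `(VC): 2A + 2 ≥ 4·1` holds iff `A ≥ 1`. -/
theorem ephi2_threshold (A : ℝ) : (4 * (1 : ℝ) ≤ 2 * A + 2) ↔ 1 ≤ A := by
  constructor <;> intro h <;> linarith

/-- The limiting kill margin of the two-scale witnesses for `Φ_A` (ripple at level `x₁ → 0⁺`,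
bulk at level `x₂ → ∞`): `4·1 − (2A + 2) = 2(1 − A) > 0` exactly when `A < 1`. -/
theorem ephi2_dead_margin (A : ℝ) (hA : A < 1) : 0 < 4 * (1 : ℝ) - (2 * A + 2) := by
  linarith


/-! ### Countersign cuts for nogo THEOREM N20 (B) / dict THEOREM DK4⁺ (the 3-D sufficiency):
different lemma cuts of the same two steps (floor transfer is `ViscousChannel.floor_transfer` in
nogo's kernel; here only the scalar consequences are recorded). -/

/-- 3-D dissipation floor: if both Hessian eigenvalues `a = Φ″(r)` (radial) and `b = Φ′(r)/r`
(tangential) are `≥ m`, then `m·(p₁ + p₂) ≤ a·p₁ + b·p₂` for the two nonnegative pieces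
`p₁ = |∇|ω||²`, `p₂ = |ω|²|∇ξ|²` of `|∇ω|²`. -/
theorem dissipation3D_floor (m a b p₁ p₂ : ℝ) (ha : m ≤ a) (hb : m ≤ b) (h₁ : 0 ≤ p₁)
    (h₂ : 0 ≤ p₂) : m * (p₁ + p₂) ≤ a * p₁ + b * p₂ := by
  nlinarith [mul_le_mul_of_nonneg_right ha h₁, mul_le_mul_of_nonneg_right hb h₂]

/-- 3-D viscous bracket under (VC): `V = −D + γ·Jg` with `D ≥ s·m·P` (floor), `0 ≤ γ ≤ cmax·ν·P/Z`
written as `γ·Z ≤ cmax·ν·P`, `Jg ≤ s·G·Z` (`G ≥ 0`), and `cmax·G ≤ m` ⇒ `V ≤ 0`. -/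
theorem viscous3D_nonpos (ν s Z P G m γ Jg D cmax : ℝ) (hν : 0 ≤ ν) (hs : 0 < s)
    (hP : 0 ≤ P) (hG : 0 ≤ G) (hγ0 : 0 ≤ γ) (hγ : γ * Z ≤ cmax * ν * P) (hJ : Jg ≤ s * G * Z)
    (hD : ν * s * m * P ≤ D) (hVC : cmax * G ≤ m) : -D + γ * Jg ≤ 0 := by
  have h1 : γ * Jg ≤ γ * (s * G * Z) := mul_le_mul_of_nonneg_left hJ hγ0
  have h2 : γ * (s * G * Z) = s * G * (γ * Z) := by ring
  have hsG : 0 ≤ s * G := mul_nonneg hs.le hG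
  have h3 : s * G * (γ * Z) ≤ s * G * (cmax * ν * P) := mul_le_mul_of_nonneg_left hγ hsG
  have h4 : s * G * (cmax * ν * P) = ν * s * P * (cmax * G) := by ring
  have h5 : ν * s * P * (cmax * G) ≤ ν * s * P * m :=
    mul_le_mul_of_nonneg_left hVC (by positivity)
  rw [h2] at h1
  nlinarith

/-- General inertial weight (N20 (B)(ii) / DK4⁺ (ii)): `W = Φ′(r)/r − cmax·⟨g⟩` is `≥ 0` when
`Φ′(r)/r ≥ m` (floor transfer), `⟨g⟩ ≤ G` and `cmax·G ≤ m`, `cmax ≥ 0`. -/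
theorem inertial_weight_general (b gbar G m cmax : ℝ) (hb : m ≤ b) (hg : gbar ≤ G)
    (hc : 0 ≤ cmax) (hVC : cmax * G ≤ m) : 0 ≤ b - cmax * gbar := by
  nlinarith [mul_le_mul_of_nonneg_left hg hc]

/-- Production bound via identity (1.1): `N ≤ α⁺·(Q·F + (1 − cmax)·Jg)`; if `Jg ≥ 0` and
`cmax ≥ 1` then `N ≤ Q·α⁺·F`. -/
theorem production_le_QF (N aplus Q F cmax Jg : ℝ) (ha : 0 ≤ aplus) (hJ : 0 ≤ Jg)
    (hc : 1 ≤ cmax) (hN : N ≤ aplus * (Q * F + (1 - cmax) * Jg)) : N ≤ Q * aplus * F := by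
  have h : (1 - cmax) * Jg ≤ 0 := mul_nonpos_of_nonpos_of_nonneg (by linarith) hJ
  nlinarith [mul_le_mul_of_nonneg_left (show Q * F + (1 - cmax) * Jg ≤ Q * F by linarith) ha]

/-- … and in general (`Jg` possibly negative, but `−Jg ≤ Q·F` from `Φ′ ≥ 0`): `N ≤ cmax·Q·α⁺·F`
(`Q·F ≥ 0` follows from `−Jg ≤ Q·F` only when used; not needed here). -/
theorem production_le_cQF (N aplus Q F cmax Jg : ℝ) (ha : 0 ≤ aplus)
    (hc : 1 ≤ cmax) (hJ : -Jg ≤ Q * F) (hN : N ≤ aplus * (Q * F + (1 - cmax) * Jg)) :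
    N ≤ cmax * Q * aplus * F := by
  have h1 : (1 - cmax) * Jg ≤ (cmax - 1) * (Q * F) := by nlinarith
  have h2 : Q * F + (1 - cmax) * Jg ≤ cmax * (Q * F) := by nlinarith
  nlinarith [mul_le_mul_of_nonneg_left h2 ha]

/-- Margin bound N20 (A′): in the kill regime `R = c·J − D` with `c·J ≤ cmax·s·G·P` and
`D ≥ s·m·P`, `m > 0`: `R/D ≤ cmax·G/m − 1`; stated multiplicatively: `m·R ≤ (cmax·G − m)·D`. -/
theorem margin_upper (R cJ D s G m cmax P : ℝ) (hR : R = cJ - D) (hcJ : cJ ≤ cmax * s * G * P)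
    (hD : s * m * P ≤ D) (hm : 0 < m) (hG : 0 ≤ G) (hc : 0 ≤ cmax) :
    m * R ≤ (cmax * G - m) * D := by
  subst hR
  have h1 : m * cJ ≤ m * (cmax * s * G * P) := mul_le_mul_of_nonneg_left hcJ hm.le
  have h2 : m * (cmax * s * G * P) = cmax * G * (s * m * P) := by ring
  have h3 : cmax * G * (s * m * P) ≤ cmax * G * D := mul_le_mul_of_nonneg_left hD (by positivity)
  nlinarith

/-- Instance for EΦ.q=2.LD.j=1: `cmax·G/m − 1 = 4·1/2 − 1 = 1` — certified margins 0.370 / 0.033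
(census-1 (cc.33a)) respect it. -/
theorem margin_bound_q2LDj1 : (4 : ℝ) * 1 / 2 - 1 = 1 := by norm_num

end Summit.NavierStokesRegularity.FunctionalMining.NoGo.EPhiVcIff
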